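import Summits.AtomisticToContinuum.HydrodynamicLimit.Theorems.JParityClosureEvenStressEnskogRungZeroOfPlateauWindow
import Summits.AtomisticToContinuum.HydrodynamicLimit.Theorems.JParityClosureEvenStressEnskogPlateauWindow
import Summits.AtomisticToContinuum.HydrodynamicLimit.Theorems.JParityClosureEvenStressEnskogRungZeroPin
import Literature.MathematicalPhysics.KineticTheory.HardSphereCanonicalTwoClusterLimit
import Literature.MathematicalPhysics.KineticTheory.HardSphereCanonicalLabelLaw
import Summits.AtomisticToContinuum.HydrodynamicLimit.Theorems.EvenStressEnskog.Negative.PairFunctionalVanishing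
import HarnessLib

/-!
# `EvenStressEnskog` (stmt-AtomisticToContinuum-13079): global equilibrium UNCONDITIONALLY, and the crux ⇔ its value-free form
# (line `liouville-continuity-pins-universal-contact-value`, lead prover-line-stmt-AtomisticToContinuum-13079-c1-0, 2026-08-16)

Two consequences of the line's landed stubs, assembled (no new mathematics in this file):

* `evenStressEnskog_rung0` — **the crux AT CONSTANT PROFILES is a theorem**: for `(a, u, θ)` constant, the J-even collisional
  momentum-transfer statistic `evenStat` of the TRUE hard-sphere flow tends to `0` in probability under the (flow-invariant)
  canonical local Gibbs law — the dynamical virial / contact theorem of the canonical hard-sphere gas on `𝕋³` at small reduced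
  density.  It is `rungZero_of_plateauWindow` (p121189: the rung-0 closure of the line `even-rung-mean-variance`,
  `EvenStressEnskog_rung0_of_plateau_contact`, re-threaded with the WINDOWED decorrelation plateau and the proved contact theorem
  `HardSphereContactTheorem_holds`) applied to `plateauWindow_of_twoCluster_labelLaw` (p120767) fed by the two Literature statics
  `vcan_append_sub_mul_le` (canonical Kirkwood–Salsburg two-cluster factorisation, p115782) and
  `integral_labelLaw_eq_integral_mul_vcan` (labelled-law densities, p119561).
* `evenStressEnskog_iff_universalContactLaw` — **the crux is EXACTLY its value-free form (U)**: `EvenStressEnskog ↔ ∃` a contact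
  law `Ỹ`, continuous on an open band, slaving the collisional momentum transfer to the local reduced density in the crux's own
  frame.  `←`: rung 0 (`evenStressEnskog_rung0` at `(1, 0, 1)`) and the identification lemma `stub_rungZeroPin` (p111010) pin
  `Ỹ = contactValue` on a band, and the band rewriting `evenStressEnskog_of_eqOn_band` (the prediction integrand vanishes where
  `ρ_r = 0` — `pairFunctional_eq_zero_of_mollifiedDensity_eq_zero` — and above the cutoff) returns the crux; `→`:
  `Ỹ := contactValue`, continuous on the analyticity band (`continuousOn_contactValue_band`).

References: D. Ruelle, *Statistical Mechanics: Rigorous Results* (1969) §4.2; H. Spohn, *Large Scale Dynamics of Interacting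
Particles* (1991) Part I §2.3–2.5; J.-P. Hansen, I. R. McDonald, *Theory of Simple Liquids* (2013) §2.5.
-/

noncomputable section

open MeasureTheory Set Filter Topology Function
open scoped ENNReal NNReal BigOperators Topology InnerProductSpace

namespace Summit.AtomisticToContinuum.HydrodynamicLimit.Theorems.EvenStressEnskog

open Literature.Analysis.FluidPDE Literature.MathematicalPhysics.KineticTheory
open Summit.AtomisticToContinuum.HydrodynamicLimit.Theses.JParityClosure

/-! ## Rung 0, unconditionally -/

/-- **`EvenStressEnskog` AT GLOBAL EQUILIBRIUM (constant profiles `a, u, θ`), UNCONDITIONALLY**: the registered stub text of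
`stub_rungZero_of_plateauWindow`'s conclusion, with the windowed plateau discharged by the two-cluster factorisation and the
labelled-law densities. [folklore] -/
theorem evenStressEnskog_rung0 :
    ∃ η₀ : ℝ, 0 < η₀ ∧ ∀ (a θ : ℝ) (u : V3), 0 < a → 0 < θ → ∃ σ₀ : ℝ, 0 < σ₀ ∧ ∀ σ : ℝ, 0 < σ → σ < σ₀ →
      ∀ Φ : (N : ℕ) → HardSphereFlow (Torus.geometry (Fin 3)) (hsDiameter σ N) (N + 1),
      ∀ τ : ℝ, 0 < τ → ∀ χ : ℝ × UnitAddTorus (Fin 3) → ℝ, Continuous χ → ∀ g : ℝ → ℝ, Continuous g →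
      (∀ a, η₀ ≤ a → g a = 0) →
      ∀ η δ : ℝ, 0 < η → 0 < δ → ∃ r₀ : ℝ, 0 < r₀ ∧ ∀ r : ℝ, 0 < r → r < r₀ →
      ∃ N₀ : ℕ, ∀ N : ℕ, N₀ ≤ N → ∀ k l : Fin 3,
        localGibbsLaw σ (fun _ => a) (fun _ => u) (fun _ => θ) N (Φ N)
          {z | η < |evenStat σ N (Φ N) τ χ g (evenMark k l) r z|} ≤ ENNReal.ofReal δ :=
  rungZero_of_plateauWindow
    (plateauWindow_of_twoCluster_labelLaw Literature.MathematicalPhysics.KineticTheory.vcan_append_sub_mul_le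
      Literature.MathematicalPhysics.KineticTheory.integral_labelLaw_eq_integral_mul_vcan)

/-! ## The band rewriting -/

/-- Definitional bridge (checked by `Iff.rfl`): `EvenStressEnskog` is the statement below with the contact LAW slot
filled by `contactValue` — the `let`-chain of the route decl is, verbatim, `collisionSum`, `mollDensity`,
`pairFunctional`, `evenMark`, `contactValue` of `EvenCollisionTubeFunctional`. [folklore] -/
theorem evenStressEnskog_iff_collisionSum :
    EvenStressEnskog ↔
    ∃ η₀ : ℝ, 0 < η₀ ∧ ∀ (a₀ θ₀ : T3 → ℝ) (u₀ : T3 → V3), Continuous a₀ → Continuous θ₀ → Continuous u₀ →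
      (∀ x, 0 < a₀ x) → (∀ x, 0 < θ₀ x) → ∃ σ₀ : ℝ, 0 < σ₀ ∧ ∀ σ : ℝ, 0 < σ → σ < σ₀ →
      ∀ Φ : (N : ℕ) → HardSphereFlow (Torus.geometry (Fin 3)) (hsDiameter σ N) (N + 1),
      ∀ τ : ℝ, 0 < τ → ∀ χ : ℝ × UnitAddTorus (Fin 3) → ℝ, Continuous χ → ∀ g : ℝ → ℝ, Continuous g →
      (∀ a, η₀ ≤ a → g a = 0) →
      ∀ η δ : ℝ, 0 < η → 0 < δ → ∃ r₀ : ℝ, 0 < r₀ ∧ ∀ r : ℝ, 0 < r → r < r₀ →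
      ∃ N₀ : ℕ, ∀ N : ℕ, N₀ ≤ N → ∀ k l : Fin 3,
        localGibbsLaw σ a₀ u₀ θ₀ N (Φ N)
          {z | η < |collisionSum σ N (Φ N) τ χ g (evenMark k l) r z -
                σ ^ 3 * ∫ s in Set.Icc (0 : ℝ) τ, ∫ x : UnitAddTorus (Fin 3),
                  χ (s, x) * g (σ ^ 3 * mollDensity r ((Φ N).flow s z) x) *
                    contactValue (σ ^ 3 * mollDensity r ((Φ N).flow s z) x) *
                    pairFunctional r (evenMark k l) ((Φ N).flow s z) x|}
          ≤ ENNReal.ofReal δ :=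
  Iff.rfl


/-- **Pointwise congruence of the prediction integrand**: for one configuration `w`, if `Ỹ = Y` on `(0, η₁)` and the cutoff `g`
vanishes on `[min η₀ η₁, ∞)`, then `χ g(σ³ρ_r) Ỹ(σ³ρ_r) B_r = χ g(σ³ρ_r) Y(σ³ρ_r) B_r` at every `x` (where `ρ_r = 0` the pair functional
vanishes, `pairFunctional_eq_zero_of_mollifiedDensity_eq_zero`; in the band the laws agree; above it the cutoff kills both). [folklore] -/
theorem predIntegrand_congr_band {Yt : ℝ → ℝ} {η₀ η₁ σ r : ℝ} (hσ : 0 < σ) (hr : 0 < r)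
    (heq : Set.EqOn Yt contactValue (Set.Ioo 0 η₁)) {g : ℝ → ℝ} (hg0 : ∀ a, min η₀ η₁ ≤ a → g a = 0)
    {N : ℕ} (χ : ℝ × UnitAddTorus (Fin 3) → ℝ) (Ξ : V3 × V3 × V3 → ℝ) (w : Config (N + 1) (Fin 3) T3) (s : ℝ)
    (x : UnitAddTorus (Fin 3)) :
    χ (s, x) * g (σ ^ 3 * mollDensity r w x) * Yt (σ ^ 3 * mollDensity r w x) * pairFunctional r Ξ w x =
      χ (s, x) * g (σ ^ 3 * mollDensity r w x) * contactValue (σ ^ 3 * mollDensity r w x) *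
        pairFunctional r Ξ w x := by
  by_cases hρ : mollDensity r w x = 0
  · have hB : pairFunctional r Ξ w x = 0 := by
      have hρ' : ∫ q, 3 / (Real.pi * r ^ 3) * max (1 - Torus.euclidDist q.1 x / r) 0 ∂(empiricalMeasure w) = 0 := by
        simpa [mollDensity, coneKernel] using hρ
      have h0 := Summit.AtomisticToContinuum.HydrodynamicLimit.Theorems.EvenStressEnskog.pairFunctional_eq_zero_of_mollifiedDensity_eq_zero
        hr Ξ w x hρ'
      simpa [pairFunctional, coneKernel, sphereMark] using h0
    rw [hB, mul_zero, mul_zero]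
  · have h0 : 0 ≤ mollDensity r w x := by
      simp only [mollDensity, coneKernel]
      exact integral_nonneg fun q =>
        Summit.AtomisticToContinuum.HydrodynamicLimit.Theorems.EvenStressEnskog.coneMollifier_nonneg hr _ _
    have hpos : 0 < σ ^ 3 * mollDensity r w x := mul_pos (pow_pos hσ 3) (lt_of_le_of_ne h0 (Ne.symm hρ))
    by_cases hlt : σ ^ 3 * mollDensity r w x < min η₀ η₁
    · rw [heq ⟨hpos, hlt.trans_le (min_le_right _ _)⟩]
    · rw [hg0 _ (not_lt.mp hlt)]
      ring


/-- **(U) with a law agreeing with `contactValue` on a band implies the crux**: shrink the threshold to `min η₀ η₁`, run (U), and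
rewrite the prediction integrand surely by `predIntegrand_congr_band`. [folklore] -/
theorem evenStressEnskog_of_eqOn_band {Yt : ℝ → ℝ} {η₀ η₁ : ℝ} (hη₀ : 0 < η₀) (hη₁ : 0 < η₁)
    (HU : ∀ (a₀ θ₀ : T3 → ℝ) (u₀ : T3 → V3), Continuous a₀ → Continuous θ₀ → Continuous u₀ →
      (∀ x, 0 < a₀ x) → (∀ x, 0 < θ₀ x) → ∃ σ₀ : ℝ, 0 < σ₀ ∧ ∀ σ : ℝ, 0 < σ → σ < σ₀ →
      ∀ Φ : (N : ℕ) → HardSphereFlow (Torus.geometry (Fin 3)) (hsDiameter σ N) (N + 1),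
      ∀ τ : ℝ, 0 < τ → ∀ χ : ℝ × UnitAddTorus (Fin 3) → ℝ, Continuous χ → ∀ g : ℝ → ℝ, Continuous g →
      (∀ a, η₀ ≤ a → g a = 0) →
      ∀ η δ : ℝ, 0 < η → 0 < δ → ∃ r₀ : ℝ, 0 < r₀ ∧ ∀ r : ℝ, 0 < r → r < r₀ →
      ∃ N₀ : ℕ, ∀ N : ℕ, N₀ ≤ N → ∀ k l : Fin 3,
        localGibbsLaw σ a₀ u₀ θ₀ N (Φ N)
          {z | η < |collisionSum σ N (Φ N) τ χ g (evenMark k l) r z -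
                σ ^ 3 * ∫ s in Set.Icc (0 : ℝ) τ, ∫ x : UnitAddTorus (Fin 3),
                  χ (s, x) * g (σ ^ 3 * mollDensity r ((Φ N).flow s z) x) *
                    Yt (σ ^ 3 * mollDensity r ((Φ N).flow s z) x) *
                    pairFunctional r (evenMark k l) ((Φ N).flow s z) x|}
          ≤ ENNReal.ofReal δ)
    (heq : Set.EqOn Yt contactValue (Set.Ioo 0 η₁)) : EvenStressEnskog := by
  refine evenStressEnskog_iff_collisionSum.mpr ⟨min η₀ η₁, lt_min hη₀ hη₁, ?_⟩
  intro a₀ θ₀ u₀ ha hθ hu ha0 hθ0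
  obtain ⟨σ₀, hσ₀, H1⟩ := HU a₀ θ₀ u₀ ha hθ hu ha0 hθ0
  refine ⟨σ₀, hσ₀, ?_⟩
  intro σ hσ hσlt Φ τ hτ χ hχ g hg hg0 η δ hη hδ
  have hg0' : ∀ a, η₀ ≤ a → g a = 0 := fun a h => hg0 a ((min_le_left η₀ η₁).trans h)
  obtain ⟨r₀, hr₀, H2⟩ := H1 σ hσ hσlt Φ τ hτ χ hχ g hg hg0' η δ hη hδ
  refine ⟨r₀, hr₀, ?_⟩
  intro r hr hrlt
  obtain ⟨N₀, H3⟩ := H2 r hr hrlt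
  refine ⟨N₀, ?_⟩
  intro N hN k l
  have key := H3 N hN k l
  have hint : ∀ (w : Config (N + 1) (Fin 3) T3) (s : ℝ) (x : UnitAddTorus (Fin 3)),
      χ (s, x) * g (σ ^ 3 * mollDensity r w x) * Yt (σ ^ 3 * mollDensity r w x) *
          pairFunctional r (evenMark k l) w x =
        χ (s, x) * g (σ ^ 3 * mollDensity r w x) * contactValue (σ ^ 3 * mollDensity r w x) *
          pairFunctional r (evenMark k l) w x :=
    fun w s x => predIntegrand_congr_band hσ hr heq hg0 χ (evenMark k l) w s x
  simp_rw [hint] at key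
  exact key


/-! ## The crux is exactly its value-free form -/

/-- **(U) ⇒ the crux**: take the slaved law `Ỹ` and its threshold from (U); specialise (U) to the constant profile `(1, 0, 1)`
and rung 0 (`evenStressEnskog_rung0`) to `a = θ = 1`, `u = 0`; the identification lemma `stub_rungZeroPin` returns a band on which
`Ỹ = contactValue`; `evenStressEnskog_of_eqOn_band` concludes. [folklore] -/
theorem evenStressEnskog_of_universalContactLaw
    (hU : ∃ Yt : ℝ → ℝ, ∃ η₀ : ℝ, 0 < η₀ ∧ ContinuousOn Yt (Set.Ioo 0 η₀) ∧
          ∀ (a₀ θ₀ : T3 → ℝ) (u₀ : T3 → V3), Continuous a₀ → Continuous θ₀ → Continuous u₀ →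
          (∀ x, 0 < a₀ x) → (∀ x, 0 < θ₀ x) → ∃ σ₀ : ℝ, 0 < σ₀ ∧ ∀ σ : ℝ, 0 < σ → σ < σ₀ →
          ∀ Φ : (N : ℕ) → HardSphereFlow (Torus.geometry (Fin 3)) (hsDiameter σ N) (N + 1),
          ∀ τ : ℝ, 0 < τ → ∀ χ : ℝ × UnitAddTorus (Fin 3) → ℝ, Continuous χ → ∀ g : ℝ → ℝ, Continuous g →
          (∀ a, η₀ ≤ a → g a = 0) →
          ∀ η δ : ℝ, 0 < η → 0 < δ → ∃ r₀ : ℝ, 0 < r₀ ∧ ∀ r : ℝ, 0 < r → r < r₀ →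
          ∃ N₀ : ℕ, ∀ N : ℕ, N₀ ≤ N → ∀ k l : Fin 3,
            localGibbsLaw σ a₀ u₀ θ₀ N (Φ N)
              {z | η < |collisionSum σ N (Φ N) τ χ g (evenMark k l) r z -
                    σ ^ 3 * ∫ s in Set.Icc (0 : ℝ) τ, ∫ x : UnitAddTorus (Fin 3),
                      χ (s, x) * g (σ ^ 3 * mollDensity r ((Φ N).flow s z) x) *
                        Yt (σ ^ 3 * mollDensity r ((Φ N).flow s z) x) *
                        pairFunctional r (evenMark k l) ((Φ N).flow s z) x|}
              ≤ ENNReal.ofReal δ) :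
    EvenStressEnskog := by
  obtain ⟨Yt, ηU, hηU, hcont, HU⟩ := hU
  obtain ⟨ηR, hηR, HR⟩ := evenStressEnskog_rung0
  have HU0 := HU (fun _ => (1 : ℝ)) (fun _ => (1 : ℝ)) (fun _ => (0 : V3))
    continuous_const continuous_const continuous_const (fun _ => one_pos) (fun _ => one_pos)
  have HR0 := HR 1 1 0 one_pos one_pos
  obtain ⟨η₁, hη₁, heq⟩ := stub_rungZeroPin Yt ηU ηR hηU hηR hcont HU0 HR0
  exact evenStressEnskog_of_eqOn_band hηU hη₁ HU heq

/-- **The crux ⇒ (U)**: `Ỹ := contactValue`, continuous on the analyticity band `(0, η_an)` (`continuousOn_contactValue_band`), threshold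
`min η₀ η_an`. [folklore] -/
theorem universalContactLaw_of_evenStressEnskog (h : EvenStressEnskog) :
    ∃ Yt : ℝ → ℝ, ∃ η₀ : ℝ, 0 < η₀ ∧ ContinuousOn Yt (Set.Ioo 0 η₀) ∧
          ∀ (a₀ θ₀ : T3 → ℝ) (u₀ : T3 → V3), Continuous a₀ → Continuous θ₀ → Continuous u₀ →
          (∀ x, 0 < a₀ x) → (∀ x, 0 < θ₀ x) → ∃ σ₀ : ℝ, 0 < σ₀ ∧ ∀ σ : ℝ, 0 < σ → σ < σ₀ →
          ∀ Φ : (N : ℕ) → HardSphereFlow (Torus.geometry (Fin 3)) (hsDiameter σ N) (N + 1),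
          ∀ τ : ℝ, 0 < τ → ∀ χ : ℝ × UnitAddTorus (Fin 3) → ℝ, Continuous χ → ∀ g : ℝ → ℝ, Continuous g →
          (∀ a, η₀ ≤ a → g a = 0) →
          ∀ η δ : ℝ, 0 < η → 0 < δ → ∃ r₀ : ℝ, 0 < r₀ ∧ ∀ r : ℝ, 0 < r → r < r₀ →
          ∃ N₀ : ℕ, ∀ N : ℕ, N₀ ≤ N → ∀ k l : Fin 3,
            localGibbsLaw σ a₀ u₀ θ₀ N (Φ N)
              {z | η < |collisionSum σ N (Φ N) τ χ g (evenMark k l) r z -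
                    σ ^ 3 * ∫ s in Set.Icc (0 : ℝ) τ, ∫ x : UnitAddTorus (Fin 3),
                      χ (s, x) * g (σ ^ 3 * mollDensity r ((Φ N).flow s z) x) *
                        Yt (σ ^ 3 * mollDensity r ((Φ N).flow s z) x) *
                        pairFunctional r (evenMark k l) ((Φ N).flow s z) x|}
              ≤ ENNReal.ofReal δ := by
  obtain ⟨η₀, hη₀, H⟩ := evenStressEnskog_iff_collisionSum.mp h
  obtain ⟨ηa, hηa, hcont⟩ := continuousOn_contactValue_band
  refine ⟨contactValue, min η₀ ηa, lt_min hη₀ hηa, hcont.mono (Set.Ioo_subset_Ioo le_rfl (min_le_right _ _)), ?_⟩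
  intro a₀ θ₀ u₀ ha hθ hu ha0 hθ0
  obtain ⟨σ₀, hσ₀, H1⟩ := H a₀ θ₀ u₀ ha hθ hu ha0 hθ0
  refine ⟨σ₀, hσ₀, fun σ hσ hσlt Φ τ hτ χ hχ g hg hg0 η δ hη hδ => ?_⟩
  exact H1 σ hσ hσlt Φ τ hτ χ hχ g hg (fun a ha' => hg0 a ((min_le_left η₀ ηa).trans ha')) η δ hη hδ

/-- **`EvenStressEnskog` ↔ (U)**: the crux is equivalent to the existence of SOME continuous slaved contact law — its thermodynamic
constant `contactValue = (3/2π) f_ex′` is supplied by the proved rung 0 and the identification lemma. [folklore] -/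
theorem evenStressEnskog_iff_universalContactLaw :
    EvenStressEnskog ↔
    ∃ Yt : ℝ → ℝ, ∃ η₀ : ℝ, 0 < η₀ ∧ ContinuousOn Yt (Set.Ioo 0 η₀) ∧
          ∀ (a₀ θ₀ : T3 → ℝ) (u₀ : T3 → V3), Continuous a₀ → Continuous θ₀ → Continuous u₀ →
          (∀ x, 0 < a₀ x) → (∀ x, 0 < θ₀ x) → ∃ σ₀ : ℝ, 0 < σ₀ ∧ ∀ σ : ℝ, 0 < σ → σ < σ₀ →
          ∀ Φ : (N : ℕ) → HardSphereFlow (Torus.geometry (Fin 3)) (hsDiameter σ N) (N + 1),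
          ∀ τ : ℝ, 0 < τ → ∀ χ : ℝ × UnitAddTorus (Fin 3) → ℝ, Continuous χ → ∀ g : ℝ → ℝ, Continuous g →
          (∀ a, η₀ ≤ a → g a = 0) →
          ∀ η δ : ℝ, 0 < η → 0 < δ → ∃ r₀ : ℝ, 0 < r₀ ∧ ∀ r : ℝ, 0 < r → r < r₀ →
          ∃ N₀ : ℕ, ∀ N : ℕ, N₀ ≤ N → ∀ k l : Fin 3,
            localGibbsLaw σ a₀ u₀ θ₀ N (Φ N)
              {z | η < |collisionSum σ N (Φ N) τ χ g (evenMark k l) r z -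
                    σ ^ 3 * ∫ s in Set.Icc (0 : ℝ) τ, ∫ x : UnitAddTorus (Fin 3),
                      χ (s, x) * g (σ ^ 3 * mollDensity r ((Φ N).flow s z) x) *
                        Yt (σ ^ 3 * mollDensity r ((Φ N).flow s z) x) *
                        pairFunctional r (evenMark k l) ((Φ N).flow s z) x|}
              ≤ ENNReal.ofReal δ :=
  ⟨universalContactLaw_of_evenStressEnskog, evenStressEnskog_of_universalContactLaw⟩

end Summit.AtomisticToContinuum.HydrodynamicLimit.Theorems.EvenStressEnskog

end
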